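import Literature.Combinatorics.Extremal.LineIntersectionsOnSurface
import Literature.Combinatorics.Extremal.LinesOnTwoSurfaces
import Literature.Combinatorics.Extremal.LowDegreeSurfaceThroughLines
import Literature.RingTheory.MvPolynomial.FormsCommonZero
import Mathlib.LinearAlgebra.CrossProduct
import Mathlib.FieldTheory.IsAlgClosed.Basic
import HarnessLib

/-!
# Lines on an algebraic surface: Taylor forms, coplanarity, quadrics through three lines,
# parallel families and "every point of a ruled surface lies on a line"

Topic `Literature/Combinatorics/Extremal`. Elementary, fully PROVED tools of the classical theory
of ruled surfaces (Salmon, *Analytic Geometry of Three Dimensions*, Ch. XIII; Kollár,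
*Szemerédi–Trotter-type theorems in dimension 3*, §7; Guth–Katz, Ann. Math. 181 (2015) §3) used by
the elementary proof of Kollár's Proposition 55 (the ruled-surface input of the incidence bound of
Stevens–de Zeeuw, `Literature.Combinatorics.Additive.stevensDeZeeuw_thm4`):

* `shiftPoly`, `taylorForm` — the Taylor forms `F_i(x; w)` of `f`, `f(x + t w) = Σ_i F_i(x; w) tⁱ`,
  as forms in `w` with coefficients polynomial in `x` (`map_eval_taylorForm`,
  `eval_add_smul_eq_sum`); a line `x + K w` lies on `{f = 0}` iff `F_i(x; w) = 0` for `1 ≤ i ≤ d`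
  (`forall_eval_add_smul_iff`);
* `linesOn f`, `lineOf a u`, `Copl` (two lines meet or are parallel) and its determinant
  criterion `copl_lineOf_iff` (`(b - a) · (u × w) = 0`);
* `exists_quadric_through_lines`, **`aeval_line_eq_zero_of_copl_three`** — three pairwise
  non-coplanar lines lie on a quadric `{G = 0}`, `deg G ≤ 2`, which then contains every line
  coplanar with all three ([GuthKatz2015, §3, proof of Cor. 3.6: "the set of all lines which
  intersect all three are one ruling of a regulus"]; [Kollar2015, Prop. 55 (proof of (4))]);
* **`eval_add_smul_eq_of_infinite_parallel`** — an irreducible surface containing infinitely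
  many lines parallel to `w` is a cylinder in the direction `w` (so on a non-cylinder every
  parallel family of lines is finite, `finite_parallel_lines`) — the affine shadow of "a cone
  has a unique vertex" for a vertex at infinity [Kollar2015, §7 ¶54];
* `dvd_of_forall_eval_eq_zero` — a polynomial vanishing on an irreducible surface over an
  algebraically closed field is divisible by its equation (Nullstellensatz);
* **`exists_line_through_of_generically_ruled`** — on a generically ruled irreducible surface
  over an algebraically closed field EVERY point lies on a line of the surface (the set of
  points lying on a line is closed: [GuthKatz2015, §3, proof of Lemma 3.4, "by a limiting
  argument"]; here by the elimination theorem
  `Literature.RingTheory.MvPolynomial.exists_eval_ne_zero_not_hasCommonZero`).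

## References
* [GuthKatz2015] L. Guth, N. H. Katz, *On the Erdős distinct distances problem in the plane*,
  Ann. of Math. 181 (2015) 155–190, §3.
* [Kollar2015] J. Kollár, *Szemerédi–Trotter-type theorems in dimension 3*, Adv. Math. 271
  (2015) 30–61, §7 (ruled surfaces), ¶54, Proposition 55.
-/

namespace Literature.Combinatorics.Extremal

open MvPolynomial Finset
open scoped Matrix
open Literature.Combinatorics.Additive.DeZeeuw (eq_of_mem_of_mem)

/-! ### Taylor forms along a moving line -/

section TaylorForms

variable {K : Type*} [Field K] {σ : Type*}

/-- `f(x + w)` as a polynomial in the variables `w` with coefficients polynomials in `x`.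
[folklore] -/
noncomputable def shiftPoly (f : MvPolynomial σ K) : MvPolynomial σ (MvPolynomial σ K) :=
  aeval (fun j => C (X j) + X j) f

/-- The `i`-th Taylor form `F_i(x; w)` of `f`: the part of `f(x + w)` homogeneous of degree `i`
in `w`. [folklore] -/
noncomputable def taylorForm (f : MvPolynomial σ K) (i : ℕ) : MvPolynomial σ (MvPolynomial σ K) :=
  homogeneousComponent i (shiftPoly f)

/-- `F_i(x; w)` is a form of degree `i` in `w`. [folklore] -/
theorem isHomogeneous_taylorForm (f : MvPolynomial σ K) (i : ℕ) :
    (taylorForm f i).IsHomogeneous i :=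
  homogeneousComponent_isHomogeneous _ _

/-- Specialising the parameters: `f(x + w)|_{x = p} = f(p + ·)`. [folklore] -/
theorem map_eval_shiftPoly (f : MvPolynomial σ K) (p : σ → K) :
    map (eval p) (shiftPoly f) = translate p f := by
  have key : ((map (eval p)).comp (aeval fun j : σ => C (X j) + X j).toRingHom :
      MvPolynomial σ K →+* MvPolynomial σ K) = (translate p).toRingHom := by
    refine ringHom_ext (fun c => ?_) (fun j => ?_)
    · simp [translate]
    · simp [translate, add_comm]
  exact congrArg (fun φ : MvPolynomial σ K →+* MvPolynomial σ K => φ f) key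

/-- Specialising the parameters in a Taylor form gives the homogeneous component of the
translate. [folklore] -/
theorem map_eval_taylorForm (f : MvPolynomial σ K) (p : σ → K) (i : ℕ) :
    map (eval p) (taylorForm f i) = homogeneousComponent i (translate p f) := by
  classical
  rw [← map_eval_shiftPoly]
  ext d
  simp only [taylorForm, coeff_map, coeff_homogeneousComponent]
  split_ifs <;> simp

/-- **Taylor expansion along a line**: `f(p + t v) = Σ_{i ≤ d} tⁱ F_i(p; v)`. [folklore] -/
theorem eval_add_smul_eq_sum (f : MvPolynomial σ K) (p v : σ → K) (t : K) :
    eval (p + t • v) f = ∑ i ∈ range (f.totalDegree + 1),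
      t ^ i * eval v (map (eval p) (taylorForm f i)) := by
  have h1 : eval (p + t • v) f = eval (t • v) (translate p f) := by
    rw [eval_translate, add_comm]
  rw [h1]
  conv_lhs => rw [← sum_homogeneousComponent (translate p f), totalDegree_translate]
  rw [map_sum]
  refine Finset.sum_congr rfl fun i _ => ?_
  rw [map_eval_taylorForm, Literature.RingTheory.MvPolynomial.eval_smul_of_isHomogeneous
    (homogeneousComponent_isHomogeneous i _)]

/-- **A line lies on the surface iff the Taylor forms of positive degree vanish**: for a point
`p` of `{f = 0}` over an infinite field, `f(p + t v) = 0` for all `t` iff `F_i(p; v) = 0` for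
`1 ≤ i ≤ deg f`. [cite: Kollar2015, Proposition 53 (proof: "expanding by the powers of t")] -/
theorem forall_eval_add_smul_iff [Infinite K] (f : MvPolynomial σ K) {p : σ → K}
    (hp : eval p f = 0) (v : σ → K) :
    (∀ t : K, eval (p + t • v) f = 0) ↔
      ∀ i, 1 ≤ i → i ≤ f.totalDegree → eval v (map (eval p) (taylorForm f i)) = 0 := by
  constructor
  · intro h i _ _
    rw [map_eval_taylorForm]
    -- transport to `Fin 3`-free statement: the tree lemma is stated for `Fin 3`; reprove here
    have key := eval_add_smul_eq_sum f p v
    -- the univariate polynomial `Σ F_i(p;v) tⁱ` vanishes identically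
    set P : Polynomial K := ∑ j ∈ range (f.totalDegree + 1),
      Polynomial.C (eval v (map (eval p) (taylorForm f j))) * Polynomial.X ^ j with hP
    have hPeval : ∀ t : K, P.eval t = eval (p + t • v) f := by
      intro t
      rw [key, hP, Polynomial.eval_finsetSum]
      refine Finset.sum_congr rfl fun j _ => ?_
      rw [Polynomial.eval_mul, Polynomial.eval_C, Polynomial.eval_pow, Polynomial.eval_X, mul_comm]
    have hP0 : P = 0 := Polynomial.funext fun t => by rw [hPeval, Polynomial.eval_zero]; exact h t
    by_cases hi : i ≤ f.totalDegree
    · have hcoeff : P.coeff i = eval v (map (eval p) (taylorForm f i)) := by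
        rw [hP, Polynomial.finsetSum_coeff, Finset.sum_eq_single i]
        · rw [Polynomial.coeff_C_mul_X_pow, if_pos rfl]
        · intro j _ hji
          rw [Polynomial.coeff_C_mul_X_pow, if_neg (Ne.symm hji)]
        · intro hi'
          exact absurd (mem_range.2 (Nat.lt_succ_of_le hi)) hi'
      rw [← map_eval_taylorForm, ← hcoeff, hP0, Polynomial.coeff_zero]
    · rw [homogeneousComponent_eq_zero _ _ (by rw [totalDegree_translate]; omega), map_zero]
  · intro h
    -- the expansion collapses to its constant term, which is `f(p) = 0`
    have hconst : ∀ t : K, eval (p + t • v) f = eval v (map (eval p) (taylorForm f 0)) := by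
      intro t
      rw [eval_add_smul_eq_sum, Finset.sum_eq_single 0]
      · rw [pow_zero, one_mul]
      · intro j hj hj0
        rw [h j (Nat.one_le_iff_ne_zero.2 hj0) (Nat.lt_succ_iff.1 (mem_range.1 hj)), mul_zero]
      · intro h0
        exact absurd (mem_range.2 (Nat.succ_pos _)) h0
    intro t
    rw [hconst t, ← hconst 0, zero_smul, add_zero, hp]

/-- The Taylor forms of degrees `1, …, d` as a family indexed by `Fin d`. [folklore] -/
noncomputable def taylorForms (f : MvPolynomial σ K) (d : ℕ) :
    Fin d → MvPolynomial σ (MvPolynomial σ K) := fun k => taylorForm f (k.1 + 1)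

/-- On the surface, a common nontrivial zero of the Taylor forms `F_1, …, F_d` (`d = deg f`) at
`p` is exactly the direction of a line of the surface through `p`.
[cite: Kollar2015, Proposition 53 (proof)] -/
theorem hasCommonZero_taylorForms_iff [Infinite K] (f : MvPolynomial σ K) {p : σ → K}
    (hp : eval p f = 0) :
    Literature.RingTheory.MvPolynomial.HasCommonZero (taylorForms f f.totalDegree) p ↔
      ∃ v : σ → K, v ≠ 0 ∧ ∀ t : K, eval (p + t • v) f = 0 := by
  unfold Literature.RingTheory.MvPolynomial.HasCommonZero
  refine exists_congr fun v => and_congr Iff.rfl ?_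
  rw [forall_eval_add_smul_iff f hp v]
  constructor
  · intro h i hi1 hid
    have := h ⟨i - 1, by omega⟩
    simp only [taylorForms] at this
    rwa [Nat.sub_add_cancel hi1] at this
  · intro h k
    exact h (k.1 + 1) (Nat.succ_pos _) k.2

end TaylorForms

/-! ### Lines, parametrized lines, coplanarity -/

section Lines

variable {K : Type*} [Field K]

/-- The set of lines (affine subspaces of dimension one) lying on the surface `{f = 0}`.
[folklore] -/
def linesOn (f : MvPolynomial (Fin 3) K) : Set (AffineSubspace K (Fin 3 → K)) :=
  {ℓ | Module.finrank K ℓ.direction = 1 ∧ ∀ z ∈ ℓ, eval z f = 0}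

/-- Membership in `linesOn`. [folklore] -/
@[simp] theorem mem_linesOn {f : MvPolynomial (Fin 3) K} {ℓ : AffineSubspace K (Fin 3 → K)} :
    ℓ ∈ linesOn f ↔ Module.finrank K ℓ.direction = 1 ∧ ∀ z ∈ ℓ, eval z f = 0 := Iff.rfl

/-- The parametrized line `{a + t u}`. [folklore] -/
def lineOf (a u : Fin 3 → K) : AffineSubspace K (Fin 3 → K) := AffineSubspace.mk' a (K ∙ u)

/-- Points of `lineOf a u`. [folklore] -/
theorem mem_lineOf {a u z : Fin 3 → K} : z ∈ lineOf a u ↔ ∃ t : K, z = a + t • u := by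
  rw [lineOf, AffineSubspace.mem_mk', Submodule.mem_span_singleton]
  constructor
  · rintro ⟨t, ht⟩
    exact ⟨t, by rw [ht]; simp⟩
  · rintro ⟨t, rfl⟩
    exact ⟨t, by simp⟩

/-- The base point lies on the line. [folklore] -/
theorem self_mem_lineOf (a u : Fin 3 → K) : a ∈ lineOf a u :=
  mem_lineOf.2 ⟨0, by rw [zero_smul, add_zero]⟩

/-- `a + t u` lies on the line. [folklore] -/
theorem add_smul_mem_lineOf (a u : Fin 3 → K) (t : K) : a + t • u ∈ lineOf a u :=
  mem_lineOf.2 ⟨t, rfl⟩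

/-- The direction of `lineOf a u` is `K ∙ u`. [folklore] -/
theorem direction_lineOf (a u : Fin 3 → K) : (lineOf a u).direction = K ∙ u :=
  AffineSubspace.direction_mk' _ _

/-- `lineOf a u` has dimension one for `u ≠ 0`. [folklore] -/
theorem finrank_direction_lineOf (a : Fin 3 → K) {u : Fin 3 → K} (hu : u ≠ 0) :
    Module.finrank K (lineOf a u).direction = 1 := by
  rw [direction_lineOf, finrank_span_singleton hu]

/-- `lineOf a u` lies on `{f = 0}` iff `f(a + t u) = 0` for all `t`. [folklore] -/
theorem lineOf_mem_linesOn_iff {f : MvPolynomial (Fin 3) K} (a : Fin 3 → K) {u : Fin 3 → K}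
    (hu : u ≠ 0) : lineOf a u ∈ linesOn f ↔ ∀ t : K, eval (a + t • u) f = 0 := by
  rw [mem_linesOn]
  constructor
  · rintro ⟨-, h⟩ t
    exact h _ (add_smul_mem_lineOf a u t)
  · intro h
    refine ⟨finrank_direction_lineOf a hu, fun z hz => ?_⟩
    obtain ⟨t, rfl⟩ := mem_lineOf.1 hz
    exact h t

/-- Every line is a `lineOf` based at any of its points. [folklore] -/
theorem exists_eq_lineOf_of_mem (ℓ : AffineSubspace K (Fin 3 → K))
    (h : Module.finrank K ℓ.direction = 1) {z : Fin 3 → K} (hz : z ∈ ℓ) :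
    ∃ u : Fin 3 → K, u ≠ 0 ∧ ℓ = lineOf z u := by
  obtain ⟨uv, hv, hmem, hdir⟩ := exists_point_dir_of_finrank_eq_one ℓ h
  refine ⟨uv.2, hv, AffineSubspace.ext_of_direction_eq (by rw [hdir, direction_lineOf])
    ⟨z, hz, self_mem_lineOf _ _⟩⟩

/-- Every line is a `lineOf`. [folklore] -/
theorem exists_eq_lineOf (ℓ : AffineSubspace K (Fin 3 → K))
    (h : Module.finrank K ℓ.direction = 1) :
    ∃ a u : Fin 3 → K, u ≠ 0 ∧ ℓ = lineOf a u := by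
  obtain ⟨uv, hv, hmem, -⟩ := exists_point_dir_of_finrank_eq_one ℓ h
  obtain ⟨u, hu, hℓ⟩ := exists_eq_lineOf_of_mem ℓ h ((hmem uv.1).2 ⟨0, by simp⟩)
  exact ⟨uv.1, u, hu, hℓ⟩

/-- Reparametrization: same line from another base point and a rescaled direction.
[folklore] -/
theorem lineOf_add_smul_smul (a u : Fin 3 → K) (s : K) {c : K} (hc : c ≠ 0) :
    lineOf (a + s • u) (c • u) = lineOf a u := by
  refine AffineSubspace.ext_of_direction_eq ?_ ⟨a + s • u, self_mem_lineOf _ _,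
    add_smul_mem_lineOf a u s⟩
  rw [direction_lineOf, direction_lineOf]
  exact Submodule.span_singleton_smul_eq (IsUnit.mk0 c hc) u

/-- Two directions span the same line iff they are proportional. [folklore] -/
theorem span_singleton_eq_iff {u w : Fin 3 → K} (hw : w ≠ 0) :
    (K ∙ u) = (K ∙ w) ↔ ∃ c : K, w = c • u := by
  constructor
  · intro h
    have : w ∈ K ∙ u := by rw [h]; exact Submodule.mem_span_singleton_self w
    obtain ⟨c, hc⟩ := Submodule.mem_span_singleton.1 this
    exact ⟨c, hc.symm⟩
  · rintro ⟨c, rfl⟩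
    have hc : c ≠ 0 := by rintro rfl; exact hw (zero_smul _ _)
    exact (Submodule.span_singleton_smul_eq (IsUnit.mk0 c hc) u).symm

/-- **Coplanar lines**: two lines of `K³` are coplanar when they meet or are parallel (equal
lines are coplanar). [folklore] -/
def Copl (ℓ m : AffineSubspace K (Fin 3 → K)) : Prop :=
  (∃ z, z ∈ ℓ ∧ z ∈ m) ∨ ℓ.direction = m.direction

/-- Coplanarity is symmetric. [folklore] -/
theorem Copl.symm {ℓ m : AffineSubspace K (Fin 3 → K)} (h : Copl ℓ m) : Copl m ℓ := by
  rcases h with ⟨z, hz, hz'⟩ | h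
  · exact Or.inl ⟨z, hz', hz⟩
  · exact Or.inr h.symm

/-- A line is coplanar with itself. [folklore] -/
theorem copl_self (ℓ : AffineSubspace K (Fin 3 → K)) : Copl ℓ ℓ := Or.inr rfl

/-- The coplanarity scalar `(b - a) · (u × w)` of the parametrized lines `{a + s u}`,
`{b + t w}` (the determinant of `u, w, b - a`). [folklore] -/
def coplDet (a u b w : Fin 3 → K) : K := (b - a) ⬝ᵥ (u ⨯₃ w)

/-- **Determinant criterion for coplanarity**: `{a + s u}` and `{b + t w}` are coplanar iff
`(b - a) · (u × w) = 0`. [folklore] -/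
theorem copl_lineOf_iff {a u b w : Fin 3 → K} (hu : u ≠ 0) (hw : w ≠ 0) :
    Copl (lineOf a u) (lineOf b w) ↔ coplDet a u b w = 0 := by
  constructor
  · rintro (⟨z, hz, hz'⟩ | h)
    · obtain ⟨s, rfl⟩ := mem_lineOf.1 hz
      obtain ⟨t, ht⟩ := mem_lineOf.1 hz'
      have hba : b - a = s • u - t • w := by
        rw [sub_eq_sub_iff_add_eq_add, ← ht, add_comm]
      rw [coplDet, hba, sub_dotProduct, smul_dotProduct, smul_dotProduct, dot_self_cross,
        dot_cross_self, smul_zero, smul_zero, sub_zero]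
    · rw [direction_lineOf, direction_lineOf, span_singleton_eq_iff hw] at h
      obtain ⟨c, rfl⟩ := h
      rw [coplDet, LinearMap.map_smul, cross_self, smul_zero, dotProduct_zero]
  · intro h
    by_cases hind : LinearIndependent K ![u, w]
    · have h' : (u ⨯₃ w) ⬝ᵥ (b - a) = 0 := by rw [dotProduct_comm]; exact h
      obtain ⟨x, y, hxy⟩ := exists_eq_lin_comb_of_cross_dot hind h'
      refine Or.inl ⟨a + x • u, add_smul_mem_lineOf a u x, mem_lineOf.2 ⟨-y, ?_⟩⟩
      have : b = a + (x • u + y • w) := by rw [← hxy]; abel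
      rw [this, neg_smul]; abel
    · obtain ⟨c, rfl⟩ := exists_eq_smul_of_not_linearIndependent hu hind
      refine Or.inr ?_
      rw [direction_lineOf, direction_lineOf, span_singleton_eq_iff hw]
      exact ⟨c, rfl⟩

/-- Distinct coplanar... : two distinct lines share at most one point, restated for `lineOf`:
if `{a + s u} ≠ {b + t w}` meet at `b + t w` and at `b + t' w` then `t = t'`. [folklore] -/
theorem param_eq_of_mem_of_mem {a u b w : Fin 3 → K} (hu : u ≠ 0) (hw : w ≠ 0)
    (hne : lineOf a u ≠ lineOf b w) {t t' : K} (ht : b + t • w ∈ lineOf a u)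
    (ht' : b + t' • w ∈ lineOf a u) : t = t' := by
  have := eq_of_mem_of_mem (finrank_direction_lineOf a hu) (finrank_direction_lineOf b hw) hne
    ht (add_smul_mem_lineOf b w t) ht' (add_smul_mem_lineOf b w t')
  have h2 : (t - t') • w = 0 := by rw [sub_smul]; exact sub_eq_zero.2 (add_left_cancel this)
  exact sub_eq_zero.1 ((smul_eq_zero.1 h2).resolve_right hw)

end Lines

/-! ### Quadrics through three lines -/

section Quadric

variable {K : Type*} [Field K]

/-- The top coefficient of a product of powers of linear polynomials. [folklore] -/
theorem coeff_prod_linear_pow {σ : Type*} (s : Finset σ) (b w : σ → K) (e : σ → ℕ) :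
    (∏ i ∈ s, (Polynomial.C (b i) + Polynomial.C (w i) * Polynomial.X) ^ e i).coeff
      (∑ i ∈ s, e i) = ∏ i ∈ s, w i ^ e i := by
  classical
  have hlin : ∀ i, (Polynomial.C (b i) + Polynomial.C (w i) * Polynomial.X).natDegree ≤ 1 :=
    fun i => (Polynomial.natDegree_add_le _ _).trans (max_le (by simp)
      (Polynomial.natDegree_C_mul_le _ _ |>.trans Polynomial.natDegree_X_le))
  have hpow : ∀ i, ((Polynomial.C (b i) + Polynomial.C (w i) * Polynomial.X) ^ e i).natDegree
      ≤ e i := fun i => (Polynomial.natDegree_pow_le_of_le _ (hlin i)).trans (by rw [mul_one])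
  induction s using Finset.induction_on with
  | empty => simp
  | @insert j s hj ih =>
    rw [Finset.prod_insert hj, Finset.sum_insert hj, Finset.prod_insert hj,
      Polynomial.coeff_mul_add_eq_of_natDegree_le (hpow j)
        ((Polynomial.natDegree_prod_le _ _).trans (Finset.sum_le_sum fun i _ => hpow i)), ih]
    congr 1
    have := Polynomial.coeff_pow_of_natDegree_le (m := e j) (hlin j)
    rw [mul_one] at this
    rw [this]
    simp

/-- **Top coefficient of the restriction to a line**: if `deg G ≤ n`, the coefficient of `tⁿ` in
`G(b + t w)` is the value at `w` of the degree-`n` form of `G` (independent of `b`).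
[folklore] -/
theorem coeff_aeval_line_of_totalDegree_le {σ : Type*} [Fintype σ] (G : MvPolynomial σ K)
    {n : ℕ} (hG : G.totalDegree ≤ n) (b w : σ → K) :
    (aeval (fun i => Polynomial.C (b i) + Polynomial.C (w i) * Polynomial.X) G).coeff n =
      eval w (homogeneousComponent n G) := by
  classical
  conv_lhs => rw [G.as_sum]
  conv_rhs => rw [G.as_sum]
  rw [map_sum, Polynomial.finsetSum_coeff, map_sum, map_sum]
  refine Finset.sum_congr rfl fun e he => ?_
  have hedeg : e.degree ≤ n := le_trans (le_totalDegree he) hG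
  rw [homogeneousComponent_of_mem (isHomogeneous_monomial _ rfl)]
  rcases hedeg.lt_or_eq with hlt | heq
  · rw [if_neg (Ne.symm hlt.ne), map_zero]
    refine Polynomial.coeff_eq_zero_of_natDegree_lt ((natDegree_aeval_line_le b w _).trans_lt ?_)
    exact (totalDegree_monomial_le _ _).trans_lt hlt
  · rw [if_pos heq.symm, eval_monomial, aeval_monomial, Polynomial.algebraMap_eq,
      Polynomial.coeff_C_mul, Finsupp.prod_fintype _ _ (fun i => by rw [pow_zero]),
      Finsupp.prod_fintype _ _ (fun i => by rw [pow_zero])]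
    congr 1
    rw [← coeff_prod_linear_pow Finset.univ b w e, ← Literature.RingTheory.MvPolynomial.finsuppDegree_eq_univ_sum,
      heq]

/-- **A quadric through three lines**: any (at most) three parametrized lines of `K³` lie on a
common surface `{G = 0}` with `G ≠ 0`, `deg G ≤ 2` ("for a quadric it is 3 conditions to contain
a line"). [cite: Kollar2015, Proposition 55 (proof of (4))] -/
theorem exists_quadric_through_lines (T : Finset ((Fin 3 → K) × (Fin 3 → K)))
    (hT : T.card ≤ 3) :
    ∃ G : MvPolynomial (Fin 3) K, G ≠ 0 ∧ G.totalDegree ≤ 2 ∧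
      ∀ l ∈ T, aeval (fun i => Polynomial.C (l.1 i) + Polynomial.C (l.2 i) * Polynomial.X) G
        = 0 :=
  exists_mvPolynomial_vanishing_on_lines T 2 (by
    have h10 : (2 + Fintype.card (Fin 3)).choose (Fintype.card (Fin 3)) = 10 := by
      rw [Fintype.card_fin]; decide
    rw [h10]; omega)

/-- In `Fin 3` there is an index different from two given ones. [folklore] -/
private theorem exists_third_index (i j : Fin 3) : ∃ k : Fin 3, k ≠ i ∧ k ≠ j := by
  fin_cases i <;> fin_cases j <;> decide

/-- **The regulus argument**: let `{G = 0}`, `deg G ≤ 2`, contain three pairwise non-coplanar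
lines `{aᵢ + t uᵢ}`. Then every line coplanar with each of the three lies on `{G = 0}` too.
(It meets them in three distinct points, or is parallel to one of them — then the `t²`
coefficient of `G` along it vanishes — and meets the other two.)
[cite: GuthKatz2015, §3, proof of Corollary 3.6] [cite: Kollar2015, Proposition 55 (4)] -/
theorem aeval_line_eq_zero_of_copl_three (G : MvPolynomial (Fin 3) K) (hG2 : G.totalDegree ≤ 2)
    (a u : Fin 3 → (Fin 3 → K))
    (hG : ∀ i, aeval (fun j => Polynomial.C (a i j) + Polynomial.C (u i j) * Polynomial.X) G = 0)
    (hskew : ∀ i j, i ≠ j → ¬ Copl (lineOf (a i) (u i)) (lineOf (a j) (u j)))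
    {b w : Fin 3 → K} (hw : w ≠ 0) (hc : ∀ i, Copl (lineOf (a i) (u i)) (lineOf b w)) :
    aeval (fun j => Polynomial.C (b j) + Polynomial.C (w j) * Polynomial.X) G = 0 := by
  classical
  set P := aeval (fun j => Polynomial.C (b j) + Polynomial.C (w j) * Polynomial.X) G with hP
  have hPdeg : P.natDegree ≤ 2 := (natDegree_aeval_line_le b w G).trans hG2
  -- `G` vanishes at the points of the three lines
  have hGpt : ∀ i (s : K), eval (a i + s • u i) G = 0 := fun i s => by
    have := congrArg (Polynomial.eval s) (hG i)
    rwa [eval_aeval_line, Polynomial.eval_zero] at this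
  -- the line `{b + t w}` is none of the three (it is coplanar with the others)
  have hne : ∀ i, lineOf (a i) (u i) ≠ lineOf b w := by
    intro i h
    obtain ⟨j, hj⟩ := exists_ne i
    exact hskew i j hj.symm (h ▸ (hc j).symm)
  -- a meeting point gives a root of `P`
  have hroot : ∀ i (t : K), b + t • w ∈ lineOf (a i) (u i) → P.eval t = 0 := by
    intro i t ht
    obtain ⟨s, hs⟩ := mem_lineOf.1 ht
    rw [hP, eval_aeval_line, hs]
    exact hGpt i s
  -- two of the lines meeting `{b + t w}` meet it at distinct parameters
  have hdist : ∀ i j (t t' : K), i ≠ j → b + t • w ∈ lineOf (a i) (u i) →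
      b + t' • w ∈ lineOf (a j) (u j) → t ≠ t' := by
    intro i j t t' hij hi hj htt
    rw [← htt] at hj
    exact hskew i j hij (Or.inl ⟨_, hi, hj⟩)
  by_cases hpar : ∃ i, (lineOf (a i) (u i)).direction = (lineOf b w).direction
  · -- parallel to line `i`: the other two meet it, and the `t²` coefficient vanishes
    obtain ⟨i, hi⟩ := hpar
    rw [direction_lineOf, direction_lineOf, span_singleton_eq_iff hw] at hi
    obtain ⟨κ, hκ⟩ := hi
    have hmeet : ∀ j, j ≠ i → ∃ t : K, b + t • w ∈ lineOf (a j) (u j) := by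
      intro j hji
      rcases hc j with ⟨z, hz, hz'⟩ | hdir
      · obtain ⟨t, rfl⟩ := mem_lineOf.1 hz'
        exact ⟨t, hz⟩
      · exfalso
        refine hskew j i hji (Or.inr ?_)
        rw [hdir, direction_lineOf, direction_lineOf, eq_comm, span_singleton_eq_iff hw]
        exact ⟨κ, hκ⟩
    have hcoeff2 : P.coeff 2 = 0 := by
      rw [hP, coeff_aeval_line_of_totalDegree_le G hG2, hκ,
        Literature.RingTheory.MvPolynomial.eval_smul_of_isHomogeneous
          (homogeneousComponent_isHomogeneous 2 G),
        ← coeff_aeval_line_of_totalDegree_le G hG2 (a i) (u i), hG i, Polynomial.coeff_zero,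
        mul_zero]
    have hPdeg1 : P.natDegree ≤ 1 := by
      by_contra h1
      have h2 : P.natDegree = 2 := by omega
      have hlc : P.leadingCoeff = 0 := by rw [Polynomial.leadingCoeff, h2, hcoeff2]
      rw [Polynomial.leadingCoeff_eq_zero] at hlc
      rw [hlc, Polynomial.natDegree_zero] at h2
      exact absurd h2 (by norm_num)
    -- the two other indices
    obtain ⟨j, hj⟩ := exists_ne i
    obtain ⟨k, hki, hkj⟩ := exists_third_index i j
    obtain ⟨tj, htj⟩ := hmeet j hj
    obtain ⟨tk, htk⟩ := hmeet k hki
    have hjk : tj ≠ tk := hdist j k tj tk (Ne.symm hkj) htj htk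
    refine Polynomial.eq_zero_of_natDegree_lt_card_of_eval_eq_zero' P {tj, tk}
      (fun t ht => ?_) ?_
    · simp only [Finset.mem_insert, Finset.mem_singleton] at ht
      rcases ht with rfl | rfl
      · exact hroot j _ htj
      · exact hroot k _ htk
    · rw [Finset.card_pair hjk]; omega
  · -- all three meet `{b + t w}` at distinct parameters
    push Not at hpar
    have hmeet : ∀ i, ∃ t : K, b + t • w ∈ lineOf (a i) (u i) := by
      intro i
      rcases hc i with ⟨z, hz, hz'⟩ | hdir
      · obtain ⟨t, rfl⟩ := mem_lineOf.1 hz'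
        exact ⟨t, hz⟩
      · exact absurd hdir (hpar i)
    choose t ht using hmeet
    have htinj : Function.Injective t := fun i j h => by
      by_contra hij; exact hdist i j (t i) (t j) hij (ht i) (ht j) h
    refine Polynomial.eq_zero_of_natDegree_lt_card_of_eval_eq_zero' P (Finset.univ.image t)
      (fun s hs => ?_) ?_
    · obtain ⟨i, -, rfl⟩ := Finset.mem_image.1 hs
      exact hroot i _ (ht i)
    · rw [Finset.card_image_of_injective _ htinj, Finset.card_univ, Fintype.card_fin]; omega

end Quadric

/-! ### A polynomial vanishing on an irreducible surface is divisible by its equation -/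

section Nullstellensatz

variable {K : Type*} [Field K] {σ : Type*}

/-- Over an algebraically closed field, a polynomial vanishing on the zero set of an irreducible
polynomial is divisible by it (Hilbert's Nullstellensatz for a principal prime ideal).
[folklore] -/
theorem dvd_of_forall_eval_eq_zero [IsAlgClosed K] [Finite σ] {f g : MvPolynomial σ K}
    (hf : Irreducible f) (h : ∀ p : σ → K, eval p f = 0 → eval p g = 0) : f ∣ g := by
  have hprime : (Ideal.span ({f} : Set (MvPolynomial σ K))).IsPrime :=
    (Ideal.span_singleton_prime hf.ne_zero).2 hf.prime
  have hg : g ∈ vanishingIdeal K (zeroLocus K (Ideal.span ({f} : Set (MvPolynomial σ K)))) := by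
    rw [mem_vanishingIdeal_iff]
    intro p hp
    rw [MvPolynomial.aeval_eq_eval]
    refine h p ?_
    have := (mem_zeroLocus_iff.1 hp) f (Ideal.subset_span rfl)
    rwa [MvPolynomial.aeval_eq_eval] at this
  rw [vanishingIdeal_zeroLocus_eq_radical, hprime.radical] at hg
  exact Ideal.mem_span_singleton.1 hg

/-- A point of an irreducible surface off a second surface not containing it. [folklore] -/
theorem exists_eval_eq_zero_and_ne_zero [IsAlgClosed K] [Finite σ] {f g : MvPolynomial σ K}
    (hf : Irreducible f) (hg : ¬ f ∣ g) : ∃ p : σ → K, eval p f = 0 ∧ eval p g ≠ 0 := by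
  by_contra! h
  exact hg (dvd_of_forall_eval_eq_zero hf h)

end Nullstellensatz

/-! ### Parallel families of lines: cylinders -/

section Cylinder

variable {K : Type*} [Field K]

/-- The coefficients `c_i(x)` of `f(x + t w) = Σ_i c_i(x) tⁱ` for a FIXED direction `w`, as
polynomials in `x`. [folklore] -/
noncomputable def dirCoeff (f : MvPolynomial (Fin 3) K) (w : Fin 3 → K) (i : ℕ) :
    MvPolynomial (Fin 3) K :=
  eval (fun j => C (w j)) (taylorForm f i)

/-- `c_i(x)` evaluates to the `i`-th Taylor form at `(x; w)`. [folklore] -/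
theorem eval_dirCoeff (f : MvPolynomial (Fin 3) K) (w x : Fin 3 → K) (i : ℕ) :
    eval x (dirCoeff f w i) = eval w (map (eval x) (taylorForm f i)) := by
  rw [dirCoeff, eval_map]
  have key : ((eval x).comp (eval fun j => C (w j)) :
      MvPolynomial (Fin 3) (MvPolynomial (Fin 3) K) →+* K) = eval₂Hom (eval x) w := by
    refine ringHom_ext (fun c => ?_) (fun j => ?_)
    · simp
    · simp
  exact congrArg (fun φ : MvPolynomial (Fin 3) (MvPolynomial (Fin 3) K) →+* K => φ _) key

/-- **Infinitely many parallel lines force a cylinder.** If the irreducible surface `{f = 0}`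
over an algebraically closed field contains infinitely many lines of direction `K ∙ w`, then
`f(p + t w) = f(p)` identically: every coefficient `c_i`, `i ≥ 1`, of `f(x + t w)` vanishes on
infinitely many lines of the surface, hence (`card_lines_on_two_surfaces_le`) is divisible by
`f`; so the surface is a union of lines parallel to `w`, and a line parallel to `w` off the
surface meets it nowhere, i.e. `f` is constant on it. (Affine form of "all lines of a cone pass
through its vertex", vertex at infinity.) [cite: Kollar2015, §7 ¶54 (cones)] -/
theorem eval_add_smul_eq_of_infinite_parallel [IsAlgClosed K] {f : MvPolynomial (Fin 3) K}
    (hf : Irreducible f) {w : Fin 3 → K} (hw : w ≠ 0)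
    (hinf : Set.Infinite {ℓ | ℓ ∈ linesOn f ∧ ℓ.direction = K ∙ w}) :
    ∀ (p : Fin 3 → K) (t : K), eval (p + t • w) f = eval p f := by
  haveI : Infinite K := IsAlgClosed.instInfinite
  -- lines of the family are `{z + t w}` through each of their points
  have hfam : ∀ ℓ, ℓ ∈ linesOn f → ℓ.direction = K ∙ w → ∀ z ∈ ℓ, ∀ t : K,
      eval (z + t • w) f = 0 := by
    intro ℓ hℓ hdir z hz t
    obtain ⟨u, hu, rfl⟩ := exists_eq_lineOf_of_mem ℓ hℓ.1 hz
    rw [direction_lineOf, span_singleton_eq_iff hw] at hdir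
    obtain ⟨c, rfl⟩ := hdir
    exact hℓ.2 _ (mem_lineOf.2 ⟨t * c, by rw [mul_smul]⟩)
  -- Step 1: `f ∣ c_i` for `i ≥ 1`
  have hdvd : ∀ i, 1 ≤ i → f ∣ dirCoeff f w i := by
    intro i hi
    by_contra hndvd
    have hrel : IsRelPrime f (dirCoeff f w i) := hf.isRelPrime_iff_not_dvd.2 hndvd
    obtain ⟨Λ, hΛsub, hΛcard⟩ :=
      hinf.exists_subset_card_eq (f.totalDegree * (dirCoeff f w i).totalDegree + 1)
    have hΛ1 : ∀ ℓ ∈ Λ, Module.finrank K ℓ.direction = 1 := fun ℓ hℓ => (hΛsub hℓ).1.1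
    have hΛf : ∀ ℓ ∈ Λ, ∀ z ∈ ℓ, eval z f = 0 := fun ℓ hℓ => (hΛsub hℓ).1.2
    have hΛg : ∀ ℓ ∈ Λ, ∀ z ∈ ℓ, eval z (dirCoeff f w i) = 0 := by
      intro ℓ hℓ z hz
      have hline := hfam ℓ (hΛsub hℓ).1 (hΛsub hℓ).2 z hz
      rw [eval_dirCoeff]
      by_cases hid : i ≤ f.totalDegree
      · exact (forall_eval_add_smul_iff f (hΛf ℓ hℓ z hz) w).1 hline i hi hid
      · rw [map_eval_taylorForm, homogeneousComponent_eq_zero _ _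
          (by rw [totalDegree_translate]; omega), map_zero]
    have := card_lines_on_two_surfaces_le hrel Λ hΛ1 hΛf hΛg
    omega
  -- Step 2: through every point of the surface, the parallel to `w` lies on the surface
  have hsurf : ∀ p : Fin 3 → K, eval p f = 0 → ∀ t : K, eval (p + t • w) f = 0 := by
    intro p hp
    refine (forall_eval_add_smul_iff f hp w).2 fun i hi _ => ?_
    rw [← eval_dirCoeff]
    obtain ⟨c, hc⟩ := hdvd i hi
    rw [hc, map_mul, hp, zero_mul]
  -- Step 3: off the surface the restriction has no root, hence is constant
  intro p t
  set P := aeval (fun j => Polynomial.C (p j) + Polynomial.C (w j) * Polynomial.X) f with hP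
  have hPev : ∀ s : K, P.eval s = eval (p + s • w) f := fun s => by rw [hP, eval_aeval_line]
  by_cases hdeg : P.degree ≤ 0
  · have hc := Polynomial.eq_C_of_degree_le_zero hdeg
    have h1 := hPev t
    have h0 := hPev 0
    rw [hc, Polynomial.eval_C] at h1 h0
    rw [zero_smul, add_zero] at h0
    rw [← h1, h0]
  · obtain ⟨t₀, ht₀⟩ := IsAlgClosed.exists_root P (fun h => hdeg h.le)
    have hz : eval (p + t₀ • w) f = 0 := by rw [← hPev]; exact ht₀
    have hp : eval p f = 0 := by
      have := hsurf _ hz (-t₀)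
      rwa [add_assoc, ← add_smul, add_neg_cancel, zero_smul, add_zero] at this
    rw [hsurf p hp t, hp]

/-- **On a non-cylinder, every parallel family of lines is finite.**
[cite: Kollar2015, §7 ¶54] -/
theorem finite_parallel_lines [IsAlgClosed K] {f : MvPolynomial (Fin 3) K} (hf : Irreducible f)
    (hcyl : ¬ ∃ v : Fin 3 → K, v ≠ 0 ∧ ∀ (p : Fin 3 → K) (t : K), eval (p + t • v) f = eval p f)
    {w : Fin 3 → K} (hw : w ≠ 0) :
    Set.Finite {ℓ | ℓ ∈ linesOn f ∧ ℓ.direction = K ∙ w} := by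
  by_contra hinf
  exact hcyl ⟨w, hw, eval_add_smul_eq_of_infinite_parallel hf hw hinf⟩

end Cylinder

/-! ### Every point of a generically ruled surface lies on a line -/

section EveryPoint

variable {K : Type*} [Field K]

/-- **Every point of a generically ruled irreducible surface lies on a line of the surface**
(the set of points lying on a line is closed and contains a dense open subset). Over an
algebraically closed field: if `f` is irreducible and through every point of `{f = 0} ∖ {h = 0}`
(`f ∤ h`) there passes a line of `{f = 0}`, then the same holds at EVERY point of `{f = 0}`.
Proof: at a point `p` without a line, the Taylor forms `F_1(p;·), …, F_d(p;·)` have no common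
nontrivial zero; by the elimination theorem
(`Literature.RingTheory.MvPolynomial.exists_eval_ne_zero_not_hasCommonZero`) this persists off a
hypersurface `{Δ = 0}` with `Δ(p) ≠ 0`, so `h Δ` vanishes on the surface and `f ∣ Δ`,
contradicting `Δ(p) ≠ 0`. [cite: GuthKatz2015, §3, proof of Lemma 3.4 ("every point lies in a
generator by a limiting argument")] -/
theorem exists_line_through_of_generically_ruled [IsAlgClosed K] {f : MvPolynomial (Fin 3) K}
    (hf : Irreducible f)
    (hgr : ∃ h : MvPolynomial (Fin 3) K, ¬ f ∣ h ∧ ∀ p : Fin 3 → K, eval p f = 0 →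
      eval p h ≠ 0 → ∃ v : Fin 3 → K, v ≠ 0 ∧ ∀ t : K, eval (p + t • v) f = 0)
    {p : Fin 3 → K} (hp : eval p f = 0) :
    ∃ v : Fin 3 → K, v ≠ 0 ∧ ∀ t : K, eval (p + t • v) f = 0 := by
  haveI : Infinite K := IsAlgClosed.instInfinite
  obtain ⟨h, hfh, hh⟩ := hgr
  by_contra hno
  have h0 : ¬ Literature.RingTheory.MvPolynomial.HasCommonZero (taylorForms f f.totalDegree) p := by
    rwa [hasCommonZero_taylorForms_iff f hp]
  obtain ⟨Δ, hΔp, hΔ⟩ :=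
    Literature.RingTheory.MvPolynomial.exists_eval_ne_zero_not_hasCommonZero
      (taylorForms f f.totalDegree) (fun k => k.1 + 1) (fun k => isHomogeneous_taylorForm f _) h0
  have hvan : ∀ q : Fin 3 → K, eval q f = 0 → eval q (h * Δ) = 0 := by
    intro q hq
    rw [map_mul]
    by_cases hhq : eval q h = 0
    · rw [hhq, zero_mul]
    · have hline := hh q hq hhq
      rw [← hasCommonZero_taylorForms_iff f hq] at hline
      by_contra hne
      exact hΔ q (right_ne_zero_of_mul hne) hline
  rcases hf.prime.dvd_or_dvd (dvd_of_forall_eval_eq_zero hf hvan) with h1 | h1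
  · exact hfh h1
  · obtain ⟨c, rfl⟩ := h1
    rw [map_mul, hp, zero_mul] at hΔp
    exact hΔp rfl

/-- The same in the language of affine lines: on a generically ruled irreducible surface over an
algebraically closed field, through every point passes a line of `linesOn f`.
[cite: GuthKatz2015, §3, proof of Lemma 3.4] -/
theorem exists_mem_linesOn_of_generically_ruled [IsAlgClosed K] {f : MvPolynomial (Fin 3) K}
    (hf : Irreducible f)
    (hgr : ∃ h : MvPolynomial (Fin 3) K, ¬ f ∣ h ∧ ∀ p : Fin 3 → K, eval p f = 0 →
      eval p h ≠ 0 → ∃ ℓ : AffineSubspace K (Fin 3 → K), Module.finrank K ℓ.direction = 1 ∧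
        p ∈ ℓ ∧ ∀ q ∈ ℓ, eval q f = 0)
    {p : Fin 3 → K} (hp : eval p f = 0) : ∃ ℓ ∈ linesOn f, p ∈ ℓ := by
  obtain ⟨h, hfh, hh⟩ := hgr
  have hgr' : ∃ h : MvPolynomial (Fin 3) K, ¬ f ∣ h ∧ ∀ p : Fin 3 → K, eval p f = 0 →
      eval p h ≠ 0 → ∃ v : Fin 3 → K, v ≠ 0 ∧ ∀ t : K, eval (p + t • v) f = 0 := by
    refine ⟨h, hfh, fun q hq hhq => ?_⟩
    obtain ⟨ℓ, hℓ1, hqℓ, hℓf⟩ := hh q hq hhq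
    obtain ⟨u, hu, rfl⟩ := exists_eq_lineOf_of_mem ℓ hℓ1 hqℓ
    exact ⟨u, hu, (lineOf_mem_linesOn_iff q hu).1 ⟨hℓ1, hℓf⟩⟩
  obtain ⟨v, hv, hline⟩ := exists_line_through_of_generically_ruled hf hgr' hp
  exact ⟨lineOf p v, (lineOf_mem_linesOn_iff p hv).2 hline, self_mem_lineOf p v⟩

end EveryPoint

end Literature.Combinatorics.Extremal
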